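import Summits.BirchSwinnertonDyer.BirchSwinnertonDyer.Theorems.CyclotomicUntwistGammaOneEigenpacketSpan
import Summits.BirchSwinnertonDyer.BirchSwinnertonDyer.Theorems.CyclotomicUntwistStabilisedUntwistFunctionalIdentity
import Literature.NumberTheory.EllipticCurves.DeligneSerreProp27LevelDescentProofs
import HarnessLib

/-!
# Stabilised oldforms of a twisted newform WITHOUT strong multiplicity one: `p ∣ level` from the
# nebentypus and the factorisation `aₙ(G) − α·𝟙_{p∣n}·a_{n/p}(G) = aₙ(f ⊗ η⁻¹)` from a uniform
# `U_p`-eigenvalue (route `CyclotomicUntwist`, child C1 `PSUntwistedLFunctionAtThree`)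

Cell `pub/bsd-wall` (D-0145 line `route-BirchSwinnertonDyer-CyclotomicUntwist`), width seat
`bsd-line-cycu-p4` (gen 12). THEOREMS ONLY (no definition, no named fact, no `sorry`); helper
`--supports stmt-BirchSwinnertonDyer-27548`. BSD is not proved by this file; C1 is not closed by it;
the cruxes K1/K2 stay open.

Sibling seat `bsd-line-cycu-p3` (gen 9) reduced C1 to PRINT plus one modular statement (★q)
(`PSStabilisedTwistQExpansion.psUntwistedLFunctionAtThree_of_print_of_qExpansion`): for the newform
`f = f_W`, a primitive `η` mod `9` and a root `α`, SOME cusp form `G` on SOME `Γ₁(L)` has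
`aₙ(G) − α·𝟙_{3∣n}·a_{n/3}(G) = η̄(n) g(η) aₙ(f)` for all `n`. Its memo (`C1-RESIDUAL-STAR-v1` §3 (N1))
asks for the OLDFORM FACTORISATION of the raw twist `h = ∑_u η(u) f(· + u/9)` over the newform `g₀` of
`f ⊗ η̄`: `h = (1 − a₃(g₀)B₃) G`, `G = ∑_{3 ∤ d} c_d g₀(d·)`. As printed this uses STRONG MULTIPLICITY ONE
ACROSS LEVELS on `Γ₁` (Li 1975, Thm. 3), which the tree has only on `Γ₀`. Here it is proved WITHOUT it,
from the hypothesis that the `U_p`-eigenvalue `a_p(g)` is the SAME number `α` for every newform `g`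
carrying the eigenpacket of `f ⊗ η⁻¹` — exactly what the Galois side delivers (Carayol:
`1 − a_p(g)T = det(1 − Frob_p T ∣ (V_ℓ ⊗ ψ_{η̄})_{I_p})` does not depend on `g`), and what strong
multiplicity one would also give.

* §4 `dvd_level_of_changeLevel_nebentypus_eq` — if the nebentypus of a level-`M₀` form induces, at a
  common level `L`, the square of a character `ψ` mod `p^c` with `ψ² ≠ 1`, then `p ∣ M₀` (Chinese
  remainder theorem on the units of `ℤ/L`); `nebentypus_apply_prime_of_changeLevel_eq`.
* §5 `exists_stabilisation_of_eigenpacket` — for a Hecke/diamond eigenvector `x` with `a_{pn}(x) = 0`: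
  if every newform `g` with the packet of `x` has `p ∣ level(g)` and `a_p(g) = α`, then
  `aₙ(G) − α·𝟙_{p∣n}·a_{n/p}(G) = aₙ(x)` for `G := ∑_{b = [α_d]g, p ∤ d} c_b b` read off any expansion of
  `x` in the eigenpacket span (`Gamma1EigenpacketSpan.mem_span_degeneracyMap1_of_eigenpacket`);
  coefficients only (`a_n([α_d]g) = d^{k-1}𝟙_{d∣n}a_{n/d}(g)`, `a_{pm}(g) = a_p(g)a_m(g)` as `p ∣ level(g)`).
* §6 `exists_stabilisedOldform_of_twist` — **the stabilised oldform factorisation of a twist**: for a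
  newform `f ∈ S_k(Γ₀(N))`, a prime `p`, a primitive `η` mod `p^c` (`c ≥ 1`) with `η² ≠ 1`, and `α ∈ ℂ`
  with `a_p(g) = α` for every newform `g` (level dividing `N p^{2c}`) carrying the packet of `f ⊗ η⁻¹`
  off `N p`: some `G ∈ S_k(Γ₁(N p^{2c}))` has `aₙ(G) − α·𝟙_{p∣n}·a_{n/p}(G) = η⁻¹(n)·g(η)·aₙ(f)` for all
  `n` — literally the coefficient clause of (★q) with `κ = 1`; `exists_newform_twist_dvd_level` — such
  newforms exist and all have `p ∣ level` (`exists_isNewform1_of_eigenpacket` + §4).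

References: [cite: DiamondShurman2005, Prop. 5.6.2, §5.7, Thm. 5.8.3] · [cite: Li1975, Thm. 3] ·
[cite: Shimura1971, Prop. 3.64] · [cite: AtkinLi1978, §3] · [cite: MazurTateTeitelbaum1986Invent, §I.14].
-/

noncomputable section

open scoped MatrixGroups

open CongruenceSubgroup UpperHalfPlane Complex Function
open Literature.NumberTheory.EllipticCurves Literature.NumberTheory.EllipticCurves.ModularForms

-- single-conjunct summit: `Summit.BirchSwinnertonDyer.BirchSwinnertonDyer.…` repeats the name by design
set_option linter.dupNamespace false
set_option autoImplicit false

open Summit.BirchSwinnertonDyer.BirchSwinnertonDyer.Theorems.Gamma1EigenpacketSpan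

namespace Summit.BirchSwinnertonDyer.BirchSwinnertonDyer.Theorems.PSStabilisedTwistOldforms

/-! ### §4 `p ∣ level` from the nebentypus -/

section Level

/-- The value at a prime `ℓ ∤ L` of a nebentypus inducing `ψ²` at level `L`: `ε(ℓ) = ψ(ℓ)²`. [folklore] -/
theorem nebentypus_apply_prime_of_changeLevel_eq {L M₀ m : ℕ} [NeZero L] [NeZero M₀] [NeZero m] {k : ℤ}
    (hM₀ : M₀ ∣ L) (hmL : m ∣ L) {g : CuspForm (Gamma1 M₀) k} {ψ : DirichletCharacter ℂ m}
    (h : DirichletCharacter.changeLevel hM₀ (nebentypus g) = DirichletCharacter.changeLevel hmL ψ ^ 2)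
    {ℓ : ℕ} (hℓ : ℓ.Prime) (hℓL : ¬ ℓ ∣ L) :
    nebentypus g (ℓ : ZMod M₀) = ψ (ℓ : ZMod m) ^ 2 := by
  have hcop : IsCoprime ((ℓ : ℕ) : ℤ) ((L : ℕ) : ℤ) := by
    rw [Int.isCoprime_iff_gcd_eq_one]; exact_mod_cast (Nat.Prime.coprime_iff_not_dvd hℓ).2 hℓL
  have e := congrArg (fun χ' : DirichletCharacter ℂ L ↦ χ' ((ℓ : ℕ) : ℤ)) h
  rw [DirichletCharacter.changeLevel_eq_cast_of_dvd' _ hM₀ hcop, MulChar.pow_apply' _ two_ne_zero,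
    DirichletCharacter.changeLevel_eq_cast_of_dvd' _ hmL hcop] at e
  push_cast at e
  exact e

/-- **`p` divides the level of every newform whose nebentypus induces `ψ²`, `ψ² ≠ 1`.** Let
`M₀ ∣ L`, `p^c ∣ L` (`c ≥ 1`), `ε` a Dirichlet character mod `M₀` and `ψ` one mod `p^c` with `ψ² ≠ 1`,
and suppose `ε` and `ψ²` induce the same character mod `L`. Then `p ∣ M₀`: otherwise, for a unit `t`
mod `p^c`, the Chinese remainder theorem gives `u` prime to `L` with `u ≡ 1 (mod M₀)` and
`u ≡ t (mod p^c)`, whence `ψ(t)² = ε(1) = 1`. [folklore] -/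
theorem dvd_level_of_changeLevel_nebentypus_eq {L M₀ p c : ℕ} [NeZero L] [NeZero M₀] [NeZero (p ^ c)]
    (hp : p.Prime) (hc : c ≠ 0) (hM₀ : M₀ ∣ L) (hmL : p ^ c ∣ L) {ε : DirichletCharacter ℂ M₀}
    {ψ : DirichletCharacter ℂ (p ^ c)} (hψ : ψ ^ 2 ≠ 1)
    (h : DirichletCharacter.changeLevel hM₀ ε = DirichletCharacter.changeLevel hmL ψ ^ 2) : p ∣ M₀ := by
  by_contra hpM₀
  obtain ⟨e, L', hpL', hL⟩ := Nat.exists_eq_pow_mul_and_not_dvd (NeZero.ne L) p hp.one_lt.ne'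
  have hcopeL' : Nat.Coprime (p ^ e) L' :=
    Nat.Coprime.pow_left e ((Nat.Prime.coprime_iff_not_dvd hp).mpr hpL')
  -- `M₀ ∣ L'` and `p^c ∣ p^e`
  have hM₀L' : M₀ ∣ L' := by
    have hcop : Nat.Coprime M₀ (p ^ e) :=
      (Nat.Coprime.pow_left e ((Nat.Prime.coprime_iff_not_dvd hp).mpr hpM₀)).symm
    exact hcop.dvd_of_dvd_mul_left (hL ▸ hM₀)
  have hce : p ^ c ∣ p ^ e := by
    have hcop : Nat.Coprime (p ^ c) L' :=
      Nat.Coprime.pow_left c ((Nat.Prime.coprime_iff_not_dvd hp).mpr hpL')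
    exact hcop.dvd_of_dvd_mul_right (hL ▸ hmL)
  apply hψ
  refine MulChar.ext fun t ↦ ?_
  -- a unit `u` mod `L` with `u ≡ t (mod p^e)` and `u ≡ 1 (mod L')`
  obtain ⟨u, hu₁, hu₂⟩ := Nat.chineseRemainder hcopeL' (t : ZMod (p ^ c)).val 1
  have htval : Nat.Coprime ((t : ZMod (p ^ c)).val) (p ^ c) := ZMod.val_coe_unit_coprime t
  have hup : Nat.Coprime u (p ^ e) := by
    rcases Nat.eq_zero_or_pos e with he | he
    · rw [he, pow_zero]; exact Nat.coprime_one_right u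
    · have htp : ¬ p ∣ (t : ZMod (p ^ c)).val := (Nat.Prime.coprime_iff_not_dvd hp).mp
        (Nat.Coprime.coprime_dvd_right (dvd_pow_self p hc) htval).symm
      have hmod : u ≡ (t : ZMod (p ^ c)).val [MOD p] := Nat.ModEq.of_dvd (dvd_pow_self p he.ne') hu₁
      have hup' : Nat.Coprime u p := by
        refine Nat.Coprime.symm ((Nat.Prime.coprime_iff_not_dvd hp).mpr fun hpu ↦ htp ?_)
        exact (hmod.dvd_iff dvd_rfl).mp hpu
      exact Nat.Coprime.pow_right e hup'
  have huL' : Nat.Coprime u L' := by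
    have hg := hu₂.gcd_eq
    rw [Nat.gcd_one_left] at hg
    exact hg
  have huL : Nat.Coprime u L := by rw [hL]; exact Nat.Coprime.mul_right hup huL'
  have hcopZ : IsCoprime ((u : ℕ) : ℤ) ((L : ℕ) : ℤ) := by
    rw [Int.isCoprime_iff_gcd_eq_one]; exact_mod_cast huL
  -- evaluate `h` at `u`
  have e1 := congrArg (fun χ' : DirichletCharacter ℂ L ↦ χ' ((u : ℕ) : ℤ)) h
  rw [DirichletCharacter.changeLevel_eq_cast_of_dvd' _ hM₀ hcopZ, MulChar.pow_apply' _ two_ne_zero,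
    DirichletCharacter.changeLevel_eq_cast_of_dvd' _ hmL hcopZ] at e1
  have huM₀ : (((u : ℕ) : ℤ) : ZMod M₀) = 1 := by
    have hmod : u ≡ 1 [MOD M₀] := Nat.ModEq.of_dvd hM₀L' hu₂
    rw [Int.cast_natCast, (ZMod.natCast_eq_natCast_iff u 1 M₀).mpr hmod, Nat.cast_one]
  have hut : (((u : ℕ) : ℤ) : ZMod (p ^ c)) = (t : ZMod (p ^ c)) := by
    have hmod : u ≡ (t : ZMod (p ^ c)).val [MOD p ^ c] := Nat.ModEq.of_dvd hce hu₁
    rw [Int.cast_natCast, (ZMod.natCast_eq_natCast_iff _ _ _).mpr hmod, ZMod.natCast_zmod_val]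
  rw [huM₀, hut, map_one] at e1
  rw [MulChar.pow_apply' _ two_ne_zero, MulChar.one_apply_coe]
  exact e1.symm

end Level

/-! ### §5 The stabilised factorisation from a uniform `U_p`-eigenvalue -/

section Stabilisation

variable {M : ℕ} [NeZero M] {k : ℤ}

/-- **The stabilised factorisation of an eigenvector killed by `U_p`, from a uniform `U_p`-eigenvalue.**
Let `x ∈ S_k(M, χ)` satisfy `T_q x = a_q x` for the primes `q ∤ M` and `a_{pn}(x) = 0` for all `n`
(`p` a prime). Suppose every newform `g` (level `M₀ ∣ M`) carrying the packet `(a, χ)` of `x` has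
`p ∣ M₀` and `a_p(g) = α`. Then some `G ∈ S_k(Γ₁(M))` has `aₙ(G) − α·𝟙_{p∣n}·a_{n/p}(G) = aₙ(x)` for
every `n`. Proof: expand `x = ∑ c_b b` over degeneracy images `b = [α_d] g` of such newforms
(`mem_span_degeneracyMap1_of_eigenpacket`) and let `G` be the sum of the terms whose prime-to-`p`
coefficients do not all vanish (so `p ∤ d`); for those, `aₙ(b) − a_p(g)𝟙_{p∣n}a_{n/p}(b) = 𝟙_{p∤n} aₙ(b)`
(`a_n([α_d]g) = d^{k-1}𝟙_{d∣n}a_{n/d}(g)`, `a_{pm}(g) = a_p(g)a_m(g)` as `p ∣ M₀`), while the discarded terms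
have no prime-to-`p` coefficients. No strong multiplicity one is used.
[cite: DiamondShurman2005, Prop. 5.6.2, §5.7, Thm. 5.8.3] [cite: AtkinLi1978, §3] -/
theorem exists_stabilisation_of_eigenpacket {x : CuspForm (Gamma1 M) k}
    {χ : DirichletCharacter ℂ M} (hxχ : x ∈ nebentypusSubspace M k χ) {a : ℕ → ℂ}
    (hT : ∀ (p : ℕ) (hp : p.Prime), ¬ p ∣ M →
      (haveI : NeZero p := ⟨hp.ne_zero⟩; heckeT (Gamma1 M) k p x) = a p • x)
    {p : ℕ} (hp : p.Prime) (hx0 : ∀ n : ℕ, cuspCoeff x (p * n) = 0) (α : ℂ)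
    (hα : ∀ (M₀ : ℕ) [NeZero M₀] (hM₀ : M₀ ∣ M) (g : CuspForm (Gamma1 M₀) k), IsNewform1 g →
      (∀ q : ℕ, q.Prime → ¬ q ∣ M → cuspCoeff g q = a q) →
      DirichletCharacter.changeLevel hM₀ (nebentypus g) = χ → p ∣ M₀ ∧ cuspCoeff g p = α) :
    ∃ G : CuspForm (Gamma1 M) k,
      ∀ n : ℕ, cuspCoeff G n - α * (if p ∣ n then cuspCoeff G (n / p) else 0) = cuspCoeff x n := by
  classical
  obtain ⟨c, t, hts, -, hsum⟩ :=
    Submodule.mem_span_iff_exists_finset_subset.mp (mem_span_degeneracyMap1_of_eigenpacket hxχ hT)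
  -- the generators with SOME non-zero prime-to-`p` coefficient satisfy the stabilised identity
  have key : ∀ b ∈ t, ¬ (∀ n : ℕ, ¬ p ∣ n → cuspCoeff b n = 0) → ∀ n : ℕ,
      cuspCoeff b n - α * (if p ∣ n then cuspCoeff b (n / p) else 0) =
        if p ∣ n then 0 else cuspCoeff b n := by
    intro b hb hPb n
    obtain ⟨M₀, _, d, _, hMd, g, hg, hga, hgχ, rfl⟩ := hts hb
    have hM₀M : M₀ ∣ M := (dvd_mul_right M₀ d).trans hMd
    obtain ⟨hpM₀, hgp⟩ := hα M₀ hM₀M g hg hga hgχ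
    have hpd : ¬ p ∣ d := by
      intro hpd
      apply hPb
      intro n hpn
      rw [cuspCoeff_degeneracyMap1 hMd, if_neg (fun hdn ↦ hpn (hpd.trans hdn)), mul_zero]
    have hcop : Nat.Coprime d p := Nat.coprime_comm.mp ((Nat.Prime.coprime_iff_not_dvd hp).mpr hpd)
    by_cases hpn : p ∣ n
    · rw [if_pos hpn, if_pos hpn, cuspCoeff_degeneracyMap1 hMd, cuspCoeff_degeneracyMap1 hMd]
      by_cases hdn : d ∣ n
      · obtain ⟨q, rfl⟩ := hpn
        have hdq : d ∣ q := hcop.dvd_of_dvd_mul_left hdn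
        obtain ⟨r, rfl⟩ := hdq
        rw [if_pos hdn, Nat.mul_div_cancel_left _ hp.pos, if_pos (dvd_mul_right d r),
          Nat.mul_div_cancel_left r (NeZero.pos d), show p * (d * r) = d * (p * r) by ring,
          Nat.mul_div_cancel_left _ (NeZero.pos d), PSStabilisedUntwist.cuspCoeff_prime_mul_of_dvd_level hg hp hpM₀, hgp]
        ring
      · have hdnp : ¬ d ∣ n / p := fun h ↦ hdn (h.trans (Nat.div_dvd_of_dvd hpn))
        rw [if_neg hdn, if_neg hdnp, mul_zero, mul_zero, sub_zero]
    · rw [if_neg hpn, if_neg hpn, mul_zero, sub_zero]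
  refine ⟨∑ b ∈ t.filter (fun b ↦ ¬ ∀ n : ℕ, ¬ p ∣ n → cuspCoeff b n = 0), c b • b, fun n ↦ ?_⟩
  by_cases hpn : p ∣ n
  · have hxn : cuspCoeff x n = 0 := by
      obtain ⟨q, rfl⟩ := hpn
      exact hx0 q
    rw [hxn, if_pos hpn, LevelDescent.cuspCoeff_sum_smul_gamma1, LevelDescent.cuspCoeff_sum_smul_gamma1, Finset.mul_sum,
      ← Finset.sum_sub_distrib]
    refine Finset.sum_eq_zero fun b hb ↦ ?_
    obtain ⟨hbt, hPb⟩ := Finset.mem_filter.mp hb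
    have hb' := key b hbt hPb n
    rw [if_pos hpn, if_pos hpn] at hb'
    calc c b * cuspCoeff b n - α * (c b * cuspCoeff b (n / p))
        = c b * (cuspCoeff b n - α * cuspCoeff b (n / p)) := by ring
      _ = 0 := by rw [hb', mul_zero]
  · rw [if_neg hpn, mul_zero, sub_zero, ← hsum, LevelDescent.cuspCoeff_sum_smul_gamma1, LevelDescent.cuspCoeff_sum_smul_gamma1]
    refine Finset.sum_filter_of_ne fun b _ hne hPb ↦ hne ?_
    rw [hPb n hpn, mul_zero]

end Stabilisation

/-! ### §6 The stabilised oldform factorisation of a twisted newform -/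

section Twist

variable {N : ℕ} [NeZero N] {k : ℤ} {p c : ℕ} [NeZero (p ^ c)] {f : CuspForm (Gamma0 N) k}
  {η : DirichletCharacter ℂ (p ^ c)}

/-- The levels: `N ∣ N p^{2c}`, `(p^c)² ∣ N p^{2c}`, `N p^c ∣ N p^{2c}`, `p^c ∣ N p^{2c}`. [folklore] -/
theorem twistLevels_dvd (N p c : ℕ) : N ∣ N * (p ^ c) ^ 2 ∧ (p ^ c) ^ 2 ∣ N * (p ^ c) ^ 2 ∧
    N * p ^ c ∣ N * (p ^ c) ^ 2 ∧ p ^ c ∣ N * (p ^ c) ^ 2 :=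
  ⟨dvd_mul_right N _, dvd_mul_left _ N, mul_dvd_mul_left N (Dvd.intro_left _ (sq (p ^ c)).symm),
    (Dvd.intro_left _ (sq (p ^ c)).symm).trans (dvd_mul_left _ N)⟩

/-- A prime not dividing `N p^c` does not divide `N p^{2c}`. [folklore] -/
theorem not_dvd_twistLevel {N p c ℓ : ℕ} (hℓ : ℓ.Prime) (hℓNm : ¬ ℓ ∣ N * p ^ c) :
    ¬ ℓ ∣ N * (p ^ c) ^ 2 := by
  intro h'
  rcases (Nat.Prime.dvd_mul hℓ).1 h' with h'' | h''
  · exact hℓNm (h''.trans (dvd_mul_right N _))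
  · exact hℓNm ((Nat.Prime.dvd_of_dvd_pow hℓ h'').trans (dvd_mul_left _ N))

/-- A prime not dividing `N p^{2c}` does not divide `N p^c`. [folklore] -/
theorem not_dvd_of_not_dvd_twistLevel {N p c ℓ : ℕ} (hℓL : ¬ ℓ ∣ N * (p ^ c) ^ 2) :
    ¬ ℓ ∣ N * p ^ c := fun h ↦
  hℓL (h.trans (mul_dvd_mul_left N (Dvd.intro_left _ (sq (p ^ c)).symm)))

/-- **The stabilised oldform factorisation of a twisted newform (no strong multiplicity one).** Let
`f ∈ S_k(Γ₀(N))` be a newform, `p` a prime, `η` a primitive Dirichlet character mod `p^c` (`c ≥ 1`)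
with `η² ≠ 1`, and `α ∈ ℂ` a number such that EVERY newform `g` (level `M₀ ∣ N p^{2c}`) with the
eigenpacket of `f ⊗ η⁻¹` off `N p` — `a_ℓ(g) = η⁻¹(ℓ) a_ℓ(f)` and `ε_g(ℓ) = η⁻¹(ℓ)²` for the primes
`ℓ ∤ N p^c` — has `a_p(g) = α`. Then there is a cusp form `G ∈ S_k(Γ₁(N p^{2c}))` with
`aₙ(G) − α·𝟙_{p∣n}·a_{n/p}(G) = η⁻¹(n)·g(η)·aₙ(f)` for every `n` (`g(η)` the Gauss sum of `η` for
`e^{2πi·/p^c}`) — the coefficient clause of the stabilised-twist statement (★q) with `κ = 1`. The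
hypothesis on `α` is what Carayol's theorem gives on the Galois side (the Euler factor of the twist at
`p` does not depend on `g`), and what strong multiplicity one on `Γ₁` would give; neither is used here.
Proof: the raw twist `h = ∑_u η(u) f(· + u/p^c) ∈ S_k(Γ₁(N p^{2c}))` has `aₙ(h) = η⁻¹(n) g(η) aₙ(f)`
(Shimura 3.64), is an eigenvector with the packet of `f ⊗ η⁻¹` (`heckeT_twistRaw1`,
`twistRaw1_mem_nebentypusSubspace`), and `a_{pn}(h) = 0`; every newform with that packet has
`p ∣ level` (`dvd_level_of_changeLevel_nebentypus_eq`); apply `exists_stabilisation_of_eigenpacket`.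
[cite: Shimura1971, Prop. 3.64] [cite: AtkinLi1978, §3] [cite: DiamondShurman2005, Thm. 5.8.3]
[cite: MazurTateTeitelbaum1986Invent, §I.14 (case p ∣ N)] -/
theorem exists_stabilisedOldform_of_twist (hf : IsNewform0 f) (hη : η.IsPrimitive) (hη2 : η ^ 2 ≠ 1)
    (hp : p.Prime) (hc : c ≠ 0) (α : ℂ)
    (hα : ∀ (M₀ : ℕ) [NeZero M₀] (g : CuspForm (Gamma1 M₀) k), IsNewform1 g → M₀ ∣ N * (p ^ c) ^ 2 →
      (∀ ℓ : ℕ, ℓ.Prime → ¬ ℓ ∣ N * p ^ c →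
        cuspCoeff g ℓ = η⁻¹ (ℓ : ZMod (p ^ c)) * cuspCoeff f ℓ ∧
          nebentypus g (ℓ : ZMod M₀) = η⁻¹ (ℓ : ZMod (p ^ c)) ^ 2) →
      cuspCoeff g p = α) :
    ∃ G : CuspForm (Gamma1 (N * (p ^ c) ^ 2)) k, ∀ n : ℕ,
      cuspCoeff G n - α * (if p ∣ n then cuspCoeff G (n / p) else 0) =
        η⁻¹ (n : ZMod (p ^ c)) * gaussSum η (ZMod.stdAddChar (N := p ^ c)) * cuspCoeff f n := by
  haveI : NeZero (N * (p ^ c) ^ 2) := ⟨mul_ne_zero (NeZero.ne N) (pow_ne_zero 2 (NeZero.ne (p ^ c)))⟩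
  obtain ⟨hN, hm, hNm, hmL⟩ := twistLevels_dvd N p c
  have hf₁ : IsNewform1 (liftToGamma1 N k f) := (isNewform1_liftToGamma1_iff_holds (N := N) (k := k) f).mpr hf
  have hf0 : f ≠ 0 := by
    intro h
    have h1 : cuspCoeff f 1 = 1 := hf.2.2
    rw [h, cuspCoeff_zero_form (one_mem_strictPeriods_gamma0 N)] at h1
    exact zero_ne_one h1
  have hε : nebentypus (liftToGamma1 N k f) = 1 := nebentypus_liftToGamma1_holds (N := N) (k := k) hf0
  have hfε := IsNewform1.mem_nebentypusSubspace_nebentypus_holds hf₁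
  set h := twistRaw1 (N * (p ^ c) ^ 2) hN hm hNm hfε η⁻¹ with hh
  -- the packet of `h`
  have hT : ∀ (q : ℕ) (hq : q.Prime), ¬ q ∣ N * (p ^ c) ^ 2 →
      (haveI : NeZero q := ⟨hq.ne_zero⟩; heckeT (Gamma1 (N * (p ^ c) ^ 2)) k q h) =
        (η⁻¹ (q : ZMod (p ^ c)) * cuspCoeff f q) • h := by
    intro q hq hqL
    haveI : NeZero q := ⟨hq.ne_zero⟩
    have h1 := heckeT_twistRaw1 _ hN hm hNm hfε (isPrimitive_inv hη) hq hqL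
      (hf₁.heckeT_apply_eq_cuspCoeff_smul q hq)
    rw [PSStabilisedUntwist.cuspCoeff_liftToGamma1] at h1
    exact h1
  have hχ : h ∈ nebentypusSubspace (N * (p ^ c) ^ 2) k
      (DirichletCharacter.changeLevel hmL η⁻¹ ^ 2) := by
    have h1 := twistRaw1_mem_nebentypusSubspace (N * (p ^ c) ^ 2) hN hm hNm hmL hfε η⁻¹
    have hchar : DirichletCharacter.changeLevel hN (nebentypus (liftToGamma1 N k f)) *
        DirichletCharacter.changeLevel hmL η⁻¹ ^ 2 = DirichletCharacter.changeLevel hmL η⁻¹ ^ 2 := by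
      rw [hε, DirichletCharacter.changeLevel_one, one_mul]
    rwa [hchar] at h1
  have hx0 : ∀ n : ℕ, cuspCoeff h (p * n) = 0 := fun n ↦ by
    rw [hh, cuspCoeff_twistRaw1 _ hN hm hNm hfε (isPrimitive_inv hη) (p * n),
      PSStabilisedUntwist.apply_natCast_eq_zero_of_dvd η⁻¹ hp (dvd_pow_self p hc) (dvd_mul_right p n),
      zero_mul, zero_mul]
  have hcoef : ∀ n : ℕ, cuspCoeff h n =
      η⁻¹ (n : ZMod (p ^ c)) * gaussSum η (ZMod.stdAddChar (N := p ^ c)) * cuspCoeff f n := fun n ↦ by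
    rw [hh, cuspCoeff_twistRaw1 _ hN hm hNm hfε (isPrimitive_inv hη) n, inv_inv,
      PSStabilisedUntwist.cuspCoeff_liftToGamma1]
  -- every newform with the packet of `h` has `p ∣ level` and `a_p = α`
  have hη2' : (η⁻¹) ^ 2 ≠ 1 := by rwa [inv_pow, Ne, inv_eq_one]
  have hα' : ∀ (M₀ : ℕ) [NeZero M₀] (hM₀ : M₀ ∣ N * (p ^ c) ^ 2) (g : CuspForm (Gamma1 M₀) k),
      IsNewform1 g →
      (∀ q : ℕ, q.Prime → ¬ q ∣ N * (p ^ c) ^ 2 → cuspCoeff g q = η⁻¹ (q : ZMod (p ^ c)) * cuspCoeff f q) →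
      DirichletCharacter.changeLevel hM₀ (nebentypus g) = DirichletCharacter.changeLevel hmL η⁻¹ ^ 2 →
      p ∣ M₀ ∧ cuspCoeff g p = α := by
    intro M₀ _ hM₀ g hg hga hgχ
    refine ⟨dvd_level_of_changeLevel_nebentypus_eq hp hc hM₀ hmL hη2' hgχ,
      hα M₀ g hg hM₀ fun ℓ hℓ hℓNm ↦ ⟨hga ℓ hℓ (not_dvd_twistLevel hℓ hℓNm), ?_⟩⟩
    exact nebentypus_apply_prime_of_changeLevel_eq hM₀ hmL hgχ hℓ (not_dvd_twistLevel hℓ hℓNm)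
  obtain ⟨G, hG⟩ := exists_stabilisation_of_eigenpacket hχ hT hp hx0 α hα'
  exact ⟨G, fun n ↦ (hG n).trans (hcoef n)⟩

/-- **Newforms of the twist exist, and all have `p` in the level.** For `f`, `p`, `η` as in
`exists_stabilisedOldform_of_twist` (`η² ≠ 1`): there is a newform `g₀` of some level `N₀ ∣ N p^{2c}`
with `p ∣ N₀` carrying the packet of `f ⊗ η⁻¹` off `N p` (`exists_isNewform1_of_eigenpacket` on the raw
twist, and `dvd_level_of_changeLevel_nebentypus_eq`); and EVERY newform `g` (level `M₀ ∣ N p^{2c}`)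
whose `T_ℓ`-eigenvalues off `N p` are those of `f ⊗ η⁻¹` and whose nebentypus induces `(η⁻¹)²` at level
`N p^{2c}` has `p ∣ M₀`. (Atkin–Li 1978, §3, for the existence; no strong multiplicity one.)
[cite: AtkinLi1978, §3] [cite: DiamondShurman2005, Thm. 5.8.2–5.8.3] -/
theorem exists_newform_twist_dvd_level (hf : IsNewform0 f) (hη : η.IsPrimitive) (hη2 : η ^ 2 ≠ 1)
    (hp : p.Prime) (hc : c ≠ 0) :
    (∃ (N₀ : ℕ) (_ : NeZero N₀) (g₀ : CuspForm (Gamma1 N₀) k), IsNewform1 g₀ ∧ N₀ ∣ N * (p ^ c) ^ 2 ∧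
      p ∣ N₀ ∧ ∀ ℓ : ℕ, ℓ.Prime → ¬ ℓ ∣ N * p ^ c →
        cuspCoeff g₀ ℓ = η⁻¹ (ℓ : ZMod (p ^ c)) * cuspCoeff f ℓ ∧
          nebentypus g₀ (ℓ : ZMod N₀) = η⁻¹ (ℓ : ZMod (p ^ c)) ^ 2) ∧
    (∀ (M₀ : ℕ) [NeZero M₀] (hM₀ : M₀ ∣ N * (p ^ c) ^ 2) (hmL : p ^ c ∣ N * (p ^ c) ^ 2)
      (g : CuspForm (Gamma1 M₀) k),
      DirichletCharacter.changeLevel hM₀ (nebentypus g) = DirichletCharacter.changeLevel hmL η⁻¹ ^ 2 →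
      p ∣ M₀) := by
  haveI : NeZero (N * (p ^ c) ^ 2) := ⟨mul_ne_zero (NeZero.ne N) (pow_ne_zero 2 (NeZero.ne (p ^ c)))⟩
  have hη2' : (η⁻¹) ^ 2 ≠ 1 := by rwa [inv_pow, Ne, inv_eq_one]
  refine ⟨?_, fun M₀ _ hM₀ hmL g hgχ ↦ dvd_level_of_changeLevel_nebentypus_eq hp hc hM₀ hmL hη2' hgχ⟩
  obtain ⟨hN, hm, hNm, hmL⟩ := twistLevels_dvd N p c
  have hf₁ : IsNewform1 (liftToGamma1 N k f) := (isNewform1_liftToGamma1_iff_holds (N := N) (k := k) f).mpr hf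
  have hf0 : f ≠ 0 := by
    intro h
    have h1 : cuspCoeff f 1 = 1 := hf.2.2
    rw [h, cuspCoeff_zero_form (one_mem_strictPeriods_gamma0 N)] at h1
    exact zero_ne_one h1
  have hε : nebentypus (liftToGamma1 N k f) = 1 := nebentypus_liftToGamma1_holds (N := N) (k := k) hf0
  have hfε := IsNewform1.mem_nebentypusSubspace_nebentypus_holds hf₁
  set h := twistRaw1 (N * (p ^ c) ^ 2) hN hm hNm hfε η⁻¹ with hh
  have hh0 : h ≠ 0 := twistRaw1_ne_zero _ hN hm hNm hfε (isPrimitive_inv hη) (by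
    rw [PSStabilisedUntwist.cuspCoeff_liftToGamma1, show cuspCoeff f 1 = 1 from hf.2.2]
    exact one_ne_zero)
  have hT : ∀ (q : ℕ) (hq : q.Prime), ¬ q ∣ N * (p ^ c) ^ 2 →
      (haveI : NeZero q := ⟨hq.ne_zero⟩; heckeT (Gamma1 (N * (p ^ c) ^ 2)) k q h) =
        (η⁻¹ (q : ZMod (p ^ c)) * cuspCoeff f q) • h := by
    intro q hq hqL
    haveI : NeZero q := ⟨hq.ne_zero⟩
    have h1 := heckeT_twistRaw1 _ hN hm hNm hfε (isPrimitive_inv hη) hq hqL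
      (hf₁.heckeT_apply_eq_cuspCoeff_smul q hq)
    rw [PSStabilisedUntwist.cuspCoeff_liftToGamma1] at h1
    exact h1
  have hχ : h ∈ nebentypusSubspace (N * (p ^ c) ^ 2) k
      (DirichletCharacter.changeLevel hmL η⁻¹ ^ 2) := by
    have h1 := twistRaw1_mem_nebentypusSubspace (N * (p ^ c) ^ 2) hN hm hNm hmL hfε η⁻¹
    have hchar : DirichletCharacter.changeLevel hN (nebentypus (liftToGamma1 N k f)) *
        DirichletCharacter.changeLevel hmL η⁻¹ ^ 2 = DirichletCharacter.changeLevel hmL η⁻¹ ^ 2 := by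
      rw [hε, DirichletCharacter.changeLevel_one, one_mul]
    rwa [hchar] at h1
  obtain ⟨N₀, _, hN₀, g₀, hg₀, hcoeff, hchar⟩ := exists_isNewform1_of_eigenpacket hh0 hχ hT
  refine ⟨N₀, inferInstance, g₀, hg₀, hN₀, dvd_level_of_changeLevel_nebentypus_eq hp hc hN₀ hmL hη2' hchar,
    fun ℓ hℓ hℓNm ↦ ⟨hcoeff ℓ hℓ (not_dvd_twistLevel hℓ hℓNm), ?_⟩⟩
  exact nebentypus_apply_prime_of_changeLevel_eq hN₀ hmL hchar hℓ (not_dvd_twistLevel hℓ hℓNm)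

end Twist

end Summit.BirchSwinnertonDyer.BirchSwinnertonDyer.Theorems.PSStabilisedTwistOldforms

end
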